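import Literature.AlgebraicGeometry.HodgeTheory.ConjugationChartExistence
import Literature.AlgebraicGeometry.HodgeTheory.RationallyNormalisedDeRhamFamily
import Literature.AlgebraicGeometry.HodgeTheory.ComplexConjugationHolds
import Literature.AlgebraicGeometry.HodgeTheory.HodgeModelExistence
import Literature.AlgebraicGeometry.HodgeTheory.GysinFormalismHodgeOfGysin
import Literature.AlgebraicGeometry.HodgeTheory.GlobalInvariantCyclesProofs
import Literature.AlgebraicGeometry.HodgeTheory.AbsoluteHodgeSplitting
import Literature.AlgebraicGeometry.HodgeTheory.HolomorphicBundleChernCharacterProofs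
import Literature.NumberTheory.Transcendental.AnalytificationConnectedProofs
import Literature.NumberTheory.Transcendental.ComplexFormsHighType
import Literature.AlgebraicGeometry.Motives.ComplexPointsManifold
import Literature.AlgebraicGeometry.Motives.ConjugateVarietyPointEval
import Literature.AlgebraicGeometry.Motives.BaseChangeProofs
import Literature.AlgebraicTopology.SingularHomology.CohomologyOfPoint
import Literature.AlgebraicTopology.SingularHomology.CupProduct
import Literature.AlgebraicTopology.SingularHomology.CompactGroupExteriorCohomology
import Literature.AlgebraicTopology.SingularHomology.SphereHomology
import Literature.Geometry.Kaehler.ChernCharacter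
import Literature.Geometry.Kaehler.ComplexTorusHodge
import Literature.Geometry.Kaehler.ManifoldFormsPullback
import HarnessLib

/-!
# Conjugation in degree zero is canonical; the unconditional absolute Hodge classes
# (degree `0`, degrees above the dimension, varieties of dimension `0`)

The tree renders Charles–Schnell's absolute Hodge classes (Def. 11.2.3) on real carriers
(`AbsoluteHodgeClasses`): the `σ`-conjugate `α ↦ α^σ` ((11.2.2)–(11.2.3)) of a class
`c ∈ Hᵏ(X(ℂ); ℂ)` is read through CONJUGATION CHARTS — a smooth affine probe `π : Y ⟶ X` with `(π^σ)^*`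
injective on `Hᵏ`, analytic models of `Y`, `Y^σ`, a natural rationally normalised de Rham family, and
an algebraic form expression representing `π^* c` (`IsConjugateClass σ X k c c'`, an `∃` over charts) —
and `IsAbsoluteHodgeClass n X p c` asks that a conjugate EXISTS for every `σ` and that EVERY conjugate be
`(2πi/σ(2πi))ᵖ •` a rational `(p,p)`-class. In general, existence needs Grothendieck's comparison theorem
(named fact `grothendieck_comparison_realize_surjective`) and single-valuedness is the named fact
`chartConjugation_canonical`. This file proves what holds WITHOUT either fact:

* **§1–§3, toolkit.** `H⁰` of a space (`Z⁰ ↪ H⁰`, pointwise injectivity, `H⁰ = R · 1` on a path-connected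
  space, rational degree-zero classes are exactly `ℚ · 1`); the DEGREE-ZERO SCALAR `unitScalar e` of a
  complex de Rham family (`e_M[1] = λ_e · 1` on EVERY `E`-manifold `M` for a natural family, `λ_e ∈ ℚˣ`
  for a rationally normalised one — the "junk analysis (2)" of `AbsoluteHodgeClasses` made a theorem in
  degree `0`); constant sections `constSection Y κ ∈ Γ(Y, 𝒪)` and constant expressions
  `AlgFormExpr.const Y κ`, whose CONJUGATE REALISES TO THE CONSTANT `σ κ` on `Y^σ` (`AlgFormExpr.realize_conj_const`:
  Charles–Schnell's "`X^σ` is defined by the conjugates of the `Pᵢ`", (11.2.1)–(11.2.2), in degree `0`).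
* **§4, charts without Jouanolou.** A conjugation chart needs from Jouanolou's device only ONE smooth
  affine probe injective on `Hᵏ(X^σ)`: `nonempty_conjugationChart_of_injective` (Serre's analytic models +
  the tree's theorem `exists_isRational_complexDeRhamIsoFamily_holds`); the identity of a smooth affine
  `Y`; a complex point of a smooth projective `X` in degree `0` (`X^σ(ℂ)` is path connected) and in
  degrees `k > 2 dim X` (`Hᵏ(X^σ) = 0`).
* **§5, DEGREE-ZERO CONJUGATION IS CANONICAL** (`isConjugateClass_degree_zero_iff`): for `X` smooth
  projective, `σ ∈ Aut ℂ` and EVERY `κ ∈ ℂ`, a class `c'` is a chart conjugate of `κ · 1_X` — in ANY chart —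
  iff `c' = σ(κ) · 1_{X^σ}`. So in degree `0` the `∃` over charts is single-valued, `σ`-semilinear and
  non-vacuous, and computes Charles–Schnell's `(λα)^σ = σ(λ) α^σ` with `1^σ = 1`: the degree-zero
  instance of the content of `chartConjugation_canonical` and of `grothendieck_comparison_realize_surjective`,
  unconditionally. (The summit file `Summits/…/BoundaryReadoutBoundarySupplyDegreeZero.lean` has existence
  and uniqueness for `κ ∈ ℚ`; the proof for `κ ∈ ℂ` is the same computation: a closed `0`-form with class
  `κ/λ_e · [1]` is the constant `κ/λ_e`, its conjugate takes the value `σ(κ/λ_e) = σ(κ)/λ_e` at every point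
  of `Y^σ` because `λ_e ∈ ℚ`, and `(π^σ)^*` is injective on `H⁰`.)
* **§6, the unconditional absolute Hodge classes.** Every rational class of degree `0` on a smooth
  projective `X` is absolute Hodge (`isAbsoluteHodgeClass_degree_zero`, Deligne's `ℚ(0)`); every class of
  degree `2p > 2 dim X` is (`isAbsoluteHodgeClass_of_lt`); hence the `p = 0` and `p > dim X` instances of
  the tree's named fact `deligne1982_cycleClass_absoluteHodge` ("the class of an algebraic cycle is
  absolute Hodge", Deligne 1982 Ex. 2.1 (a)) are THEOREMS (`cycleClass_absoluteHodge_degree_zero`,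
  `cycleClass_absoluteHodge_of_lt`) — the first non-vacuous instances of `IsAbsoluteHodgeClass` in
  `Literature/`; the per-variety properties of Charles–Schnell 11.2.17 / 11.2.18
  (`HodgeClassesAreAbsoluteHodgeFor`, `AbsoluteHodgeClassesAreAlgebraicFor` of `AbsoluteHodgeSplitting`)
  reduce to the Hodge range `1 ≤ p ≤ dim X` and HOLD OUTRIGHT for varieties of dimension `0`; the
  conjugation formula for algebraic classes (the binder (Z) of `CycleClassesAbsoluteHodgeOfCanonical`)
  holds in degree `0` and above the dimension.
* **§7, (G) in degree `0` and above the real dimension.** The degree-zero instance of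
  `grothendieck_comparison_realize_surjective` for IRREDUCIBLE smooth affine `Y` (closed `0`-forms on the
  connected `Y^an` are constants, hence regular) and its instances in degrees `k > 2m` (no forms), proved
  outright.

These are the Literature-side forms (re-homed, `Literature/` cannot import `Summits/`) of the summit
files `BoundaryReadoutBoundarySupplyDegreeZeroCharts`, `BoundaryReadoutBoundarySupplyDegreeZero` and the
chart constructions of `BoundaryReadoutBoundarySupplyZeroFloor`, extended from `ℚ` to `ℂ` in §5. No named
fact is introduced or consumed.

## References

* F. Charles, C. Schnell, *Notes on absolute Hodge classes*, in *Hodge Theory*, Math. Notes 49 (2014),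
  §11.2.2 (11.2.1)–(11.2.3), Def. 11.2.3 (PDF pp. 464–465); §11.2.5, 11.2.17–11.2.18 (PDF p. 474).
* P. Deligne, *Hodge cycles on abelian varieties*, LNM 900 (1982), §1 (`ℚ(0)`), §2 Ex. 2.1 (a).
* A. Hatcher, *Algebraic Topology* (2002), §3.1 p. 199 (`H⁰`), Thm. 3.26.
* R. Bott, L. Tu, *Differential Forms in Algebraic Topology* (1982), §I.1, §I.5.
* J.-P. Serre, *Géométrie algébrique et géométrie analytique* (1956), §2.
-/

noncomputable section

open scoped Manifold ContDiff
open CategoryTheory CategoryTheory.Limits AlgebraicGeometry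
open Literature.AlgebraicTopology.SingularHomology
open Literature.NumberTheory.Transcendental Literature.Geometry.Kaehler

namespace Literature.AlgebraicGeometry.HodgeTheory

open Motives

/-! ### §1 `H⁰` toolkit: the unit class, pointwise injectivity, rational classes -/

section HZero

variable {R : Type} [CommRing R] {M : Type} [TopologicalSpace M]

/-- In degree `0` the quotient map `Z⁰ ⟶ H⁰` is injective (no coboundaries), for any coefficient
ring. [cite: HatcherAT2002, §3.1 p. 199] -/
theorem singularCohomology_π_zero_injective : Function.Injective (singularCohomology.π R R M 0) := by
  haveI : IsIso (singularCohomology.π R R M 0) := by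
    change IsIso ((singularCochainComplex R R M).homologyπ 0)
    exact (CochainComplex.isoHomologyπ₀ (singularCochainComplex R R M)).isIso_hom
  exact (ModuleCat.mono_iff_injective (singularCohomology.π R R M 0)).1 inferInstance

/-- A `0`-simplex pushed along a constant map is the `0`-simplex at the constant. [cite: HatcherAT2002, §2.1] -/
private theorem SingularSimplex.map_const_eq_ofPoint {P : Type} [TopologicalSpace P]
    (τ : SingularSimplex P 0) (x : M) : τ.map (ContinuousMap.const P x) = SingularSimplex.ofPoint x := by
  rw [← SingularSimplex.ofPoint_pt (τ.map (ContinuousMap.const P x))]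
  congr 1

/-- **Pointwise injectivity of `H⁰`.** A class in `H⁰(M; R)` whose pull-back along every constant
map `P → M` (from a fixed nonempty probe `P`) vanishes is zero: a `0`-cocycle is a function on points,
and `(const x)^♯` evaluates it at `x`. [cite: HatcherAT2002, §3.1 p. 199] -/
theorem singularCohomology_zero_eq_zero_of_forall_const {P : Type} [TopologicalSpace P] [Nonempty P]
    (z : singularCohomology R R M 0)
    (hz : ∀ x : M, singularCohomology.map R R (ContinuousMap.const P x) 0 z = 0) : z = 0 := by
  induction z using singularCohomology_induction_on with
  | h w =>
    have hw : ∀ x : M, singularCochainComplex.cocyclesMap R R (ContinuousMap.const P x) 0 w = 0 := by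
      intro x
      apply singularCohomology_π_zero_injective
      rw [← singularCohomology.map_π, hz x, map_zero]
    have : w = 0 := by
      apply (ModuleCat.mono_iff_injective (singularCochainComplex.iCocycles R R M 0)).1 inferInstance
      rw [map_zero]
      refine singularCochainComplex.ext fun τ ↦ ?_
      obtain ⟨p⟩ := ‹Nonempty P›
      have h := congrArg (fun v ↦ (singularCochainComplex.iCocycles R R P 0 v) (SingularSimplex.ofPoint p))
        (hw τ.pt)
      simp only [map_zero, singularCochainComplex.iCocycles_cocyclesMap,
        singularCochainComplex.map_apply] at h
      rw [SingularSimplex.map_const_eq_ofPoint, SingularSimplex.ofPoint_pt] at h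
      exact h
    rw [this, map_zero]

/-- The unit `1 ∈ H⁰(M; R)` of a NONEMPTY space is nonzero for a nontrivial coefficient ring (its
cocycle takes the value `1` at a point, and `Z⁰ ⟶ H⁰` is injective). [cite: HatcherAT2002, §3.2 p. 211] -/
theorem singularCohomology_one_ne_zero [Nontrivial R] [Nonempty M] : singularCohomology.one R M ≠ 0 := by
  intro h
  rw [singularCohomology.one] at h
  have h2 := singularCohomology_π_zero_injective (h.trans (map_zero _).symm)
  have h3 := congrArg
    (fun v ↦ (singularCochainComplex.iCocycles R R M 0 v) (SingularSimplex.ofPoint (Classical.arbitrary M))) h2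
  simp only [singularCochainComplex.iCocycles_mk, map_zero] at h3
  exact one_ne_zero h3

/-- On a nonempty space, `a · 1 = b · 1` in `H⁰(M; K)` forces `a = b` (`K` a field).
[cite: HatcherAT2002, §3.2 p. 211] -/
theorem smul_one_injective {K : Type} [Field K] [Nonempty M] {a b : K}
    (h : a • singularCohomology.one K M = b • singularCohomology.one K M) : a = b := by
  have h2 : (a - b) • singularCohomology.one K M = 0 := by rw [sub_smul, h, sub_self]
  rcases smul_eq_zero.1 h2 with h3 | h3
  · exact sub_eq_zero.1 h3
  · exact absurd h3 singularCohomology_one_ne_zero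

/-- **Rational classes of degree `0` are exactly the rational multiples of `1`** on a path-connected
space: a `ℚ`-valued `0`-cocycle is the constant `q`, whose class is `q · 1`; conversely `q · 1` is
rational. [cite: HatcherAT2002, §3.1 p. 199] -/
theorem isRationalClass_zero_iff [PathConnectedSpace M] {c : singularCohomology ℂ ℂ M 0} :
    IsRationalClass c ↔ ∃ q : ℚ, c = (q : ℂ) • singularCohomology.one ℂ M := by
  constructor
  · rintro ⟨z, rfl, hz⟩
    obtain ⟨q, hq⟩ := hz (SingularSimplex.ofPoint (Classical.arbitrary M))
    refine ⟨q, ?_⟩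
    conv_lhs => rw [singularCohomology.eq_smul_one ℂ (singularCohomology.π ℂ ℂ M 0 z)]
    rw [singularCohomologyZeroEquiv_π, singularCochainComplex.cocyclesZeroEquiv_apply, ← hq]
    rfl
  · rintro ⟨q, rfl⟩
    exact (isRationalClass_one M).smul q

end HZero

/-! ### §2 The degree-zero scalar of a de Rham family: `e_M[1] = λ_e · 1`, `λ_e ∈ ℚˣ` -/

section UnitScalar

variable {E : Type} [NormedAddCommGroup E] [NormedSpace ℂ E]

/-- The unit de Rham class pulls back to the unit de Rham class along a `C^∞` map (`f^* 1 = 1` on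
functions). [cite: BottTu1982Forms, §I.1] -/
theorem complexDeRhamCohomology_map_one {M N : Type} [TopologicalSpace M] [ChartedSpace E M]
    [IsManifold 𝓘(ℝ, E) ∞ M] [TopologicalSpace N] [ChartedSpace E N] [IsManifold 𝓘(ℝ, E) ∞ N]
    {f : M → N} (hf : ContMDiff 𝓘(ℝ, E) 𝓘(ℝ, E) ∞ f) :
    complexDeRhamCohomology.map E hf 0 (complexDeRhamCohomology.one E N) = complexDeRhamCohomology.one E M := by
  rw [complexDeRhamCohomology.one, complexDeRhamCohomology.map_mk, complexDeRhamCohomology.one]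
  rfl

/-- In degree `0` there are no exact forms, so a closed `0`-form IS its de Rham class: `[α] = [β] → α = β`.
[cite: BottTu1982Forms, §I.1] -/
theorem complexDeRhamCohomology_mk_zero_injective {M : Type} [TopologicalSpace M] [ChartedSpace E M] :
    Function.Injective (complexDeRhamCohomology.mk E M 0) := by
  intro α β h
  rw [complexDeRhamCohomology.mk_eq_mk_iff] at h
  change (α : MForm 𝓘(ℝ, E) M ℂ 0) - β ∈ (⊥ : Submodule ℂ _) at h
  rw [Submodule.mem_bot, sub_eq_zero] at h
  exact Subtype.ext h

/-- A closed smooth `0`-form whose de Rham class is `κ · [1]` IS the constant form `κ · 1` (no exact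
`0`-forms), hence takes the value `κ` everywhere. [cite: BottTu1982Forms, §I.1] -/
theorem apply_eq_of_mk_eq_smul_one {M : Type} [TopologicalSpace M] [ChartedSpace E M]
    {α : MForm 𝓘(ℝ, E) M ℂ 0} (hα : α ∈ cclosedSmoothForms E M 0) {κ : ℂ}
    (h : complexDeRhamCohomology.mk E M 0 ⟨α, hα⟩ = κ • complexDeRhamCohomology.one E M) (x : M)
    (v : Fin 0 → E) : α x v = κ := by
  rw [complexDeRhamCohomology.one, ← map_smul] at h
  have h2 := congrArg (fun β : cclosedSmoothForms E M 0 ↦ (β : MForm 𝓘(ℝ, E) M ℂ 0) x v)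
    (complexDeRhamCohomology_mk_zero_injective h)
  simpa [coe_cclosedOne, MForm.ofFun_apply] using h2

/-- Conversely, a closed `0`-form taking the value `κ` everywhere has de Rham class `κ · [1]`.
[cite: BottTu1982Forms, §I.1] -/
theorem mk_eq_smul_one_of_forall_apply_eq {M : Type} [TopologicalSpace M] [ChartedSpace E M]
    {α : MForm 𝓘(ℝ, E) M ℂ 0} (hα : α ∈ cclosedSmoothForms E M 0) {κ : ℂ}
    (h : ∀ x : M, α x Fin.elim0 = κ) :
    complexDeRhamCohomology.mk E M 0 ⟨α, hα⟩ = κ • complexDeRhamCohomology.one E M := by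
  rw [complexDeRhamCohomology.one, ← map_smul]
  congr 1
  apply Subtype.ext
  rw [Submodule.coe_smul, coe_cclosedOne]
  funext x
  ext v
  rw [Subsingleton.elim v Fin.elim0, h x]
  simp [MForm.ofFun_apply]

/-- The unit de Rham class of a nonempty manifold is nonzero (the constant function `1` is not the
zero form). [cite: BottTu1982Forms, §I.1] -/
theorem complexDeRhamCohomology_one_ne_zero {M : Type} [TopologicalSpace M] [ChartedSpace E M] [Nonempty M] :
    complexDeRhamCohomology.one E M ≠ 0 := by
  intro h
  rw [complexDeRhamCohomology.one, ← (complexDeRhamCohomology.mk E M 0).map_zero] at h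
  have h2 := congrArg (fun α : cclosedSmoothForms E M 0 ↦ (α : MForm 𝓘(ℝ, E) M ℂ 0) (Classical.arbitrary M) Fin.elim0)
    (complexDeRhamCohomology_mk_zero_injective h)
  simp [coe_cclosedOne, MForm.ofFun_apply] at h2

/-- `e_M[κ · 1] = (κ λ) · 1` as soon as `e_M[1] = λ · 1`: the comparison of a constant closed `0`-form.
[cite: BottTu1982Forms, §I.5] -/
theorem apply_mk_smul_cclosedOne (e : ComplexDeRhamIsoFamily E) {M : Type} [TopologicalSpace M]
    [ChartedSpace E M] [IsManifold 𝓘(ℝ, E) ∞ M] [T2Space M] [SigmaCompactSpace M] {l : ℂ}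
    (hl : e M 0 (complexDeRhamCohomology.one E M) = l • singularCohomology.one ℂ M) (κ : ℂ) :
    e M 0 (complexDeRhamCohomology.mk E M 0 (κ • cclosedOne E M)) = (κ * l) • singularCohomology.one ℂ M := by
  rw [map_smul, ← complexDeRhamCohomology.one, map_smul, hl, smul_smul]

variable [FiniteDimensional ℂ E]

/-- **The degree-zero scalar `λ_e` of a complex de Rham comparison family `e` on `E`-manifolds**: the
coordinate of `e_E[1] ∈ H⁰(E; ℂ) = ℂ · 1` (the model space `E` is path connected). For de Rham's
integration family `λ_e = 1`; rescaling a natural family by `t₀` in degree `0` gives `λ_e = t₀`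
(junk analysis (2) of `AbsoluteHodgeClasses`). [cite: BottTu1982Forms, §I.5] -/
def unitScalar (e : ComplexDeRhamIsoFamily E) : ℂ :=
  singularCohomologyZeroEquiv ℂ ℂ E (e E 0 (complexDeRhamCohomology.one E E))

/-- On the model space, `e_E[1] = λ_e · 1` (definition of `λ_e`). [cite: BottTu1982Forms, §I.5] -/
theorem apply_one_self_eq_unitScalar_smul (e : ComplexDeRhamIsoFamily E) :
    e E 0 (complexDeRhamCohomology.one E E) = unitScalar e • singularCohomology.one ℂ E :=
  singularCohomology.eq_smul_one ℂ _

/-- The degree-zero scalar is nonzero (`e_E` is injective and `[1] ≠ 0`). [cite: BottTu1982Forms, §I.5] -/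
theorem unitScalar_ne_zero (e : ComplexDeRhamIsoFamily E) : unitScalar e ≠ 0 := by
  intro h
  have hE := apply_one_self_eq_unitScalar_smul e
  rw [h, zero_smul, ← (e E 0).map_zero] at hE
  exact complexDeRhamCohomology_one_ne_zero ((e E 0).injective hE)

/-- **A NATURAL family has ONE degree-zero scalar on all `E`-manifolds**: `e_M[1] = λ_e · 1 ∈ H⁰(M; ℂ)` for
EVERY manifold `M` charted on `E` (possibly disconnected) — `λ_e` is transported from `E` to `M` along the
constant maps `E → M` (naturality; `f^* 1 = 1` on both sides) by pointwise injectivity of `H⁰`.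
[cite: BottTu1982Forms, §I.5] -/
theorem apply_one_eq_unitScalar_smul {e : ComplexDeRhamIsoFamily E} (he : e.IsNatural) (M : Type)
    [TopologicalSpace M] [ChartedSpace E M] [IsManifold 𝓘(ℝ, E) ∞ M] [T2Space M] [SigmaCompactSpace M] :
    e M 0 (complexDeRhamCohomology.one E M) = unitScalar e • singularCohomology.one ℂ M := by
  rw [← sub_eq_zero]
  refine singularCohomology_zero_eq_zero_of_forall_const (P := E) _ fun x ↦ ?_
  have hc : ContMDiff 𝓘(ℝ, E) 𝓘(ℝ, E) ∞ (fun _ : E ↦ x) := contMDiff_const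
  have hnat := he E M (fun _ ↦ x) hc 0 (complexDeRhamCohomology.one E M)
  rw [complexDeRhamCohomology_map_one hc, apply_one_self_eq_unitScalar_smul] at hnat
  have hconst : (⟨fun _ ↦ x, hc.continuous⟩ : C(E, M)) = ContinuousMap.const E x := rfl
  rw [hconst] at hnat
  rw [map_sub, map_smul, singularCohomology.map_one, ← hnat, sub_self]

/-- `e_M[κ · 1] = (κ λ_e) · 1` on every `E`-manifold, for a natural family. [cite: BottTu1982Forms, §I.5] -/
theorem apply_mk_smul_cclosedOne_eq {e : ComplexDeRhamIsoFamily E} (he : e.IsNatural) {M : Type}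
    [TopologicalSpace M] [ChartedSpace E M] [IsManifold 𝓘(ℝ, E) ∞ M] [T2Space M] [SigmaCompactSpace M]
    (κ : ℂ) :
    e M 0 (complexDeRhamCohomology.mk E M 0 (κ • cclosedOne E M)) =
      (κ * unitScalar e) • singularCohomology.one ℂ M :=
  apply_mk_smul_cclosedOne e (apply_one_eq_unitScalar_smul he M) κ

/-- **The degree-zero scalar is RATIONAL for a natural family rationally normalised in degree `0`**
(`IsRationalDeRhamFamily e 0`): on a complex torus `E/Λ` (any real frame `Λ` of `E`) the constant `0`-form
`1` has the rational value `1` on the (empty) lattice `0`-tuples, so `e[1] = λ_e · 1` is a rational class,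
and rational degree-zero classes are `ℚ · 1`. This is the cancellation "`c₀ ∈ ℚˣ`" of the junk analysis (2)
of `AbsoluteHodgeClasses`, in degree `0`. [cite: BottTu1982Forms, §I.5]
[cite: GriffithsHarris1978, Ch. 2 §6 (cohomology of complex tori)] -/
theorem unitScalar_mem_range_ratCast {e : ComplexDeRhamIsoFamily E} (he : e.IsNatural)
    (hr : IsRationalDeRhamFamily e 0) : unitScalar e ∈ Set.range ((↑) : ℚ → ℂ) := by
  let Φ : (Fin (Module.finrank ℝ E) → ℝ) ≃L[ℝ] E := (Module.finBasis ℝ E).equivFunL.symm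
  let a : E [⋀^Fin 0]→L[ℝ] ℂ := ContinuousAlternatingMap.constOfIsEmpty ℝ E (Fin 0) 1
  have ha : ∀ v : Fin 0 → Fin (Module.finrank ℝ E),
      a (fun j ↦ Φ (Pi.single (v j) 1)) ∈ Set.range (algebraMap ℚ ℂ) := fun v ↦ ⟨1, by simp [a]⟩
  have hrat := hr (Fin (Module.finrank ℝ E)) Φ a ha
  have hcc : ComplexTorus.cconstClass Φ a = complexDeRhamCohomology.one E (ComplexTorus Φ) := by
    rw [ComplexTorus.cconstClass_apply, complexDeRhamCohomology.one]
    congr 1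
  rw [hcc, apply_one_eq_unitScalar_smul he] at hrat
  obtain ⟨q, hq⟩ := isRationalClass_zero_iff.1 hrat
  exact ⟨q, (smul_one_injective hq).symm⟩

/-- The rational degree-zero scalar, as a rational number `q` with `e_M[1] = q · 1` on all `E`-manifolds.
[cite: BottTu1982Forms, §I.5] -/
theorem exists_rat_unitScalar {e : ComplexDeRhamIsoFamily E} (he : e.IsNatural)
    (hr : IsRationalDeRhamFamily e 0) :
    ∃ q : ℚ, (q : ℂ) ≠ 0 ∧ (q : ℂ) = unitScalar e := by
  obtain ⟨q, hq⟩ := unitScalar_mem_range_ratCast he hr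
  exact ⟨q, hq ▸ unitScalar_ne_zero e, hq⟩

end UnitScalar

/-! ### §3 Constant sections and constant expressions; their conjugates -/

section Const

variable {Y : SchemeOver ℂ}

/-- The **constant global function** `κ · 1 ∈ Γ(Y, 𝒪)` on a `ℂ`-scheme `Y`: the pull-back of
`κ ∈ ℂ = Γ(Spec ℂ, 𝒪)` along the structure morphism. [folklore] -/
def constSection (Y : SchemeOver ℂ) (κ : ℂ) : Γ(Y.left, ⊤) :=
  Y.hom.appTop ((Scheme.ΓSpecIso (.of ℂ)).inv κ)

/-- The constant function `κ · 1` takes the value `κ` at every complex point (`P ≫ Y.hom = 𝟙`: an `L`-point is a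
section of the structure morphism). [cite: Hartshorne1977, II Ex. 2.7] -/
theorem eval_top_constSection (P : ComplexPoints Y) (κ : ℂ) : P.eval ⊤ trivial (constSection Y κ) = κ := by
  rw [AlgPoints.eval_top, constSection]
  change (Scheme.ΓSpecIso (.of ℂ)).hom (P.toSpecHom.appTop (Y.hom.appTop _)) = κ
  rw [← CategoryTheory.comp_apply (Y.hom.appTop) (P.toSpecHom.appTop),
    ← Scheme.Hom.comp_appTop, ComplexPoints.toSpecHom_comp_hom]
  simp

/-- The constant function `κ · 1`, as a total function on complex points, is the constant `κ`.
[cite: Hartshorne1977, II Ex. 2.7] -/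
theorem evalOrZero_top_constSection (P : ComplexPoints Y) (κ : ℂ) :
    AlgPoints.evalOrZero ⊤ (constSection Y κ) P = κ := by
  rw [AlgPoints.evalOrZero_of_mem _ (TopologicalSpace.Opens.mem_top _), eval_top_constSection]

/-- **Conjugation of constants is `σ`**: pulling the constant `κ` back along `Y^σ → Y` gives the
constant `σ κ` for the `ℂ`-structure of `Y^σ` — the tree's `conjugateVariety σ Y` is the base change
along `σ` itself (pullback square `fst ≫ Y.hom = snd ≫ Spec σ` and naturality of `ΓSpecIso`). This is
Charles–Schnell's "`X^σ` is defined by the conjugates of the `Pᵢ` by `σ`" on constants.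
[cite: CharlesSchnell2014Notes, §11.2.2 (11.2.1)–(11.2.2)] -/
theorem appTop_baseChangeHomFst_constSection (σ : ℂ ≃+* ℂ) (Y : SchemeOver ℂ) (κ : ℂ) :
    (baseChangeHomFst σ.toRingHom Y).appTop (constSection Y κ) = constSection (conjugateVariety σ Y) (σ κ) := by
  have e2 := DFunLike.congr_fun (congrArg CommRingCat.Hom.hom
    (Scheme.ΓSpecIso_inv_naturality (CommRingCat.ofHom σ.toRingHom))) κ
  simp only [CommRingCat.hom_comp, RingHom.comp_apply, CommRingCat.hom_ofHom] at e2
  have hB := congrArg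
    (fun φ ↦ (Scheme.Hom.appTop φ).hom ((Scheme.ΓSpecIso (.of ℂ)).inv.hom κ))
    (pullback.condition (f := Y.hom) (g := Spec.map (CommRingCat.ofHom σ.toRingHom)))
  exact hB.trans (congrArg
    (fun t ↦ (Scheme.Hom.appTop
      (pullback.snd Y.hom (Spec.map (CommRingCat.ofHom σ.toRingHom)))).hom t) e2.symm)

variable {E : Type} [NormedAddCommGroup E] [NormedSpace ℂ E] [FiniteDimensional ℂ E] {m : ℕ}

/-- A regular function, read on an analytic model, is its (total) value at the corresponding complex
point. [cite: SerreGAGA1956, §2] -/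
theorem AnalyticModel.regularFun_apply (A : AnalyticModel E m Y) (s : Γ(Y.left, ⊤)) (x : A.carrier) :
    A.regularFun s x = AlgPoints.evalOrZero ⊤ s (A.toComplexPoints x) :=
  rfl

/-- The constant function `κ · 1` reads as the constant `κ` on any analytic model. [cite: SerreGAGA1956, §2] -/
theorem AnalyticModel.regularFun_constSection (A : AnalyticModel E m Y) (κ : ℂ) (x : A.carrier) :
    A.regularFun (constSection Y κ) x = κ :=
  evalOrZero_top_constSection _ κ

/-- A `0`-form expression `∑ⱼ fⱼ` realises to the function `x ↦ ∑ⱼ fⱼ(x)` (as a `0`-form: its value on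
the empty tuple). [cite: Grothendieck1966, Thm. 1'] -/
theorem AlgFormExpr.realize_apply_of_degree_zero (ξ : AlgFormExpr Y 0) (A : AnalyticModel E m Y)
    (x : A.carrier) (v : Fin 0 → E) : ξ.realize A x v = ∑ j : Fin ξ.size, A.regularFun (ξ.coef j) x := by
  unfold AlgFormExpr.realize
  rw [Finset.sum_apply, ContinuousAlternatingMap.sum_apply]
  refine Finset.sum_congr rfl fun j _ ↦ ?_
  simp [dWedge, MForm.ofFun_apply]

/-- **The conjugate of a `0`-form expression takes at `x ∈ (Y^σ)^an` the value `σ` of the value of the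
expression at the UNTWISTED complex point of `Y`** (`AlgPoints.ofConjugate`: `Spec σ⁻¹ ≫ x ≫ pr₁`):
conjugation of functions is `σ` on values, `(pr₁^* f)(x) = σ(f(x₀))` (Charles–Schnell (11.2.2) in degree
`0`, the tree's `AlgPoints.evalOrZero_appTop_conjFst`). [cite: CharlesSchnell2014Notes, §11.2.2 (11.2.2)] -/
theorem AlgFormExpr.realize_conj_apply_of_degree_zero (σ : ℂ ≃+* ℂ) (ξ : AlgFormExpr Y 0)
    (A' : AnalyticModel E m (conjugateVariety σ Y)) (x : A'.carrier) (v : Fin 0 → E) :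
    (ξ.conj σ).realize A' x v =
      σ (∑ j : Fin ξ.size, AlgPoints.evalOrZero ⊤ (ξ.coef j)
        (AlgPoints.ofConjugate σ Y (A'.toComplexPoints x))) := by
  rw [AlgFormExpr.realize_apply_of_degree_zero, map_sum]
  refine Finset.sum_congr rfl fun j _ ↦ ?_
  change A'.regularFun ((baseChangeHomFst σ.toRingHom Y).appTop (ξ.coef j)) x = _
  rw [AnalyticModel.regularFun_apply]
  exact AlgPoints.evalOrZero_appTop_conjFst _ _

/-- **The constant expression `κ · 1`** on `Y`: one monomial, coefficient the constant function `κ`, no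
differentials. [cite: Grothendieck1966, Thm. 1'] -/
def AlgFormExpr.const (Y : SchemeOver ℂ) (κ : ℂ) : AlgFormExpr Y 0 :=
  ⟨1, fun _ ↦ constSection Y κ, fun _ ↦ Fin.elim0⟩

/-- The constant expression `κ · 1` realises to the constant `0`-form `κ`. [cite: Grothendieck1966, Thm. 1'] -/
theorem AlgFormExpr.realize_const (A : AnalyticModel E m Y) (κ : ℂ) :
    (AlgFormExpr.const Y κ).realize A = κ • MForm.ofFun 𝓘(ℝ, E) fun _ : A.carrier ↦ (1 : ℂ) := by
  funext x
  ext v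
  rw [AlgFormExpr.realize_apply_of_degree_zero]
  simp only [AlgFormExpr.const, Finset.univ_unique, Fin.default_eq_zero, Finset.sum_singleton]
  rw [AnalyticModel.regularFun_constSection]
  simp [MForm.ofFun_apply]

/-- The constant expression realises to a closed form, namely `κ • cclosedOne`. [cite: BottTu1982Forms, §I.1] -/
theorem AlgFormExpr.realize_const_eq_smul_cclosedOne (A : AnalyticModel E m Y) (κ : ℂ) :
    (AlgFormExpr.const Y κ).realize A = ((κ • cclosedOne E A.carrier : cclosedSmoothForms E A.carrier 0) :
      MForm 𝓘(ℝ, E) A.carrier ℂ 0) := by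
  rw [AlgFormExpr.realize_const, Submodule.coe_smul, coe_cclosedOne]

/-- The realisation of the constant expression is closed. [cite: BottTu1982Forms, §I.1] -/
theorem AlgFormExpr.realize_const_mem (A : AnalyticModel E m Y) (κ : ℂ) :
    (AlgFormExpr.const Y κ).realize A ∈ cclosedSmoothForms E A.carrier 0 := by
  rw [AlgFormExpr.realize_const_eq_smul_cclosedOne]
  exact (κ • cclosedOne E A.carrier).2

/-- **The conjugate of the constant expression `κ · 1` realises to the constant `σ κ`** on any analytic
model of `Y^σ`: conjugation of constants is `σ` (`appTop_baseChangeHomFst_constSection`), Charles–Schnell's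
"`X^σ` is defined by the conjugates of the `Pᵢ` by `σ`" in degree `0`. [cite: CharlesSchnell2014Notes, §11.2.2 (11.2.2)] -/
theorem AlgFormExpr.realize_conj_const (σ : ℂ ≃+* ℂ) (A' : AnalyticModel E m (conjugateVariety σ Y)) (κ : ℂ) :
    ((AlgFormExpr.const Y κ).conj σ).realize A' = σ κ • MForm.ofFun 𝓘(ℝ, E) fun _ : A'.carrier ↦ (1 : ℂ) := by
  funext x
  ext v
  rw [AlgFormExpr.realize_apply_of_degree_zero]
  simp only [AlgFormExpr.const, AlgFormExpr.conj, Finset.univ_unique, Fin.default_eq_zero,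
    Finset.sum_singleton]
  rw [appTop_baseChangeHomFst_constSection, AnalyticModel.regularFun_constSection]
  simp [MForm.ofFun_apply]

/-- The conjugate of the constant expression realises to `σ κ • cclosedOne`. [cite: CharlesSchnell2014Notes, §11.2.2 (11.2.2)] -/
theorem AlgFormExpr.realize_conj_const_eq_smul_cclosedOne (σ : ℂ ≃+* ℂ)
    (A' : AnalyticModel E m (conjugateVariety σ Y)) (κ : ℂ) :
    ((AlgFormExpr.const Y κ).conj σ).realize A' =
      ((σ κ • cclosedOne E A'.carrier : cclosedSmoothForms E A'.carrier 0) : MForm 𝓘(ℝ, E) A'.carrier ℂ 0) := by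
  rw [AlgFormExpr.realize_conj_const, Submodule.coe_smul, coe_cclosedOne]

/-- The conjugate of the constant expression realises to a closed form. [cite: CharlesSchnell2014Notes, §11.2.2 (11.2.2)] -/
theorem AlgFormExpr.realize_conj_const_mem (σ : ℂ ≃+* ℂ) (A' : AnalyticModel E m (conjugateVariety σ Y))
    (κ : ℂ) : ((AlgFormExpr.const Y κ).conj σ).realize A' ∈ cclosedSmoothForms E A'.carrier 0 := by
  rw [AlgFormExpr.realize_conj_const_eq_smul_cclosedOne]
  exact (σ κ • cclosedOne E A'.carrier).2

end Const

/-! ### §4 Probes and conjugation charts without Jouanolou's device -/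

section Probe

variable {n : ℕ} {X : SchemeOver ℂ}

/-- **The conjugate of a scheme with a complex point has a complex point**: `P ∈ Y(ℂ)` gives the
`ℂ`-point `(Spec σ ≫ P, 𝟙)` of `Y^σ = Y ×_{ℂ,σ} Spec ℂ`. [cite: CharlesSchnell2014Notes, §11.2.2 (11.2.1)] -/
theorem nonempty_complexPoints_conjugateVariety (σ : ℂ ≃+* ℂ) {Y : SchemeOver ℂ}
    [h : Nonempty (ComplexPoints Y)] : Nonempty (ComplexPoints (conjugateVariety σ Y)) := by
  obtain ⟨P⟩ := h
  exact ⟨(ComplexPoints.homEquiv ((baseChangeHom σ.toRingHom).obj Y)).symm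
    ⟨pullback.lift (Spec.map (CommRingCat.ofHom σ.toRingHom) ≫ P.toSpecHom) (𝟙 _)
        (by rw [Category.assoc, P.toSpecHom_comp_hom, Category.comp_id, Category.id_comp]),
      pullback.lift_snd _ _ _⟩⟩

/-- `g^* 1 = 1` on `H⁰(–(ℂ); ℂ)` for a `ℂ`-morphism `g`. [cite: HatcherAT2002, §3.2 p. 211] -/
private theorem map_one_complexBetti {Y Z : SchemeOver ℂ} (g : Y ⟶ Z) :
    complexBetti.map g 0 (singularCohomology.one ℂ (ComplexPoints Z)) = singularCohomology.one ℂ (ComplexPoints Y) :=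
  singularCohomology.map_one _

/-- **A complex point is an affine probe injective on `H⁰`**: for `Z(ℂ)` path connected, every
`ℂ`-morphism `g : Y ⟶ Z` from a `Y` with a complex point is injective on `H⁰(–(ℂ); K)`
(`H⁰(Z(ℂ)) = K · 1` and `g^* 1 = 1 ≠ 0`), for any coefficient field `K`. [cite: HatcherAT2002, §3.1 p. 199] -/
theorem singularCohomology_map_zero_injective {K : Type} [Field K] {Y Z : SchemeOver ℂ} (g : Y ⟶ Z)
    [PathConnectedSpace (ComplexPoints Z)] [Nonempty (ComplexPoints Y)] :
    Function.Injective (singularCohomology.map K K (AlgPoints.mapContinuous (L := ℂ) g) 0) := by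
  intro a b hab
  rw [singularCohomology.eq_smul_one K a, singularCohomology.eq_smul_one K b] at hab ⊢
  rw [map_smul, map_smul, singularCohomology.map_one] at hab
  rw [smul_one_injective hab]

/-- The complex-coefficient case, typed on `complexBetti`: a `ℂ`-morphism from a scheme with a complex
point into one with path-connected complex points is injective on `H⁰(–(ℂ); ℂ)`. [cite: HatcherAT2002, §3.1 p. 199] -/
theorem complexBetti_map_zero_injective {Y Z : SchemeOver ℂ} (g : Y ⟶ Z)
    [PathConnectedSpace (ComplexPoints Z)] [Nonempty (ComplexPoints Y)] :
    Function.Injective (complexBetti.map g 0) :=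
  singularCohomology_map_zero_injective (K := ℂ) g

/-- If `g^*` is injective on `H⁰(–(ℂ); ℂ)` and the target has a complex point, so does the source (else
`H⁰` of the source vanishes and `g^* 1 = g^* 0`). [cite: HatcherAT2002, §3.1] -/
theorem nonempty_complexPoints_of_injective {Y Z : SchemeOver ℂ} (g : Y ⟶ Z) [Nonempty (ComplexPoints Z)]
    (hg : Function.Injective (complexBetti.map g 0)) : Nonempty (ComplexPoints Y) := by
  by_contra h
  haveI : IsEmpty (ComplexPoints Y) := not_nonempty_iff.1 h
  haveI : Subsingleton (complexBetti Y 0) :=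
    ModuleCat.subsingleton_of_isZero (isZero_singularCohomology_of_isEmpty ℂ ℂ (E := ComplexPoints Y) 0)
  have h1 : complexBetti.map g 0 (singularCohomology.one ℂ (ComplexPoints Z)) = complexBetti.map g 0 0 :=
    Subsingleton.elim _ _
  exact singularCohomology_one_ne_zero (hg h1)

/-- `specOver ℂ ℂ → Spec ℂ` (`Spec` of the identity) is smooth of relative dimension `0`. [folklore] -/
instance smoothOfRelativeDimension_specOver_hom : SmoothOfRelativeDimension 0 (specOver ℂ ℂ).hom := by
  haveI : IsIso (specOver ℂ ℂ).hom := by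
    change IsIso (Spec.map (CommRingCat.ofHom (RingHom.id ℂ)))
    rw [CommRingCat.ofHom_id]
    infer_instance
  infer_instance

/-- `specOver ℂ ℂ` is affine. [folklore] -/
instance isAffine_specOver_left : IsAffine (specOver ℂ ℂ).left :=
  inferInstanceAs (IsAffine (Spec _))

/-- **Charts from one cohomologically injective affine probe.** A `ℂ`-morphism `π : Y ⟶ X` from a
smooth AFFINE `Y` (of relative dimension `m`) with `π^σ` injective on `Hᵏ(–(ℂ); ℂ)` gives a conjugation
chart for `(σ, X, k)`: Serre's analytic models of `Y` and `Y^σ` charted on `ℂᵐ`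
(`nonempty_analyticModel_of_isAffine`) and a natural, rationally normalised de Rham family on
`ℂᵐ`-manifolds (the tree's theorem `exists_isRational_complexDeRhamIsoFamily_holds`) are unconditional; of
Jouanolou's device only the injectivity is ever used. [cite: CharlesSchnell2014Notes, §11.2.2 (11.2.1)–(11.2.3)]
[cite: SerreGAGA1956, §2] -/
theorem nonempty_conjugationChart_of_injective (σ : ℂ ≃+* ℂ) {m : ℕ} {Y X : SchemeOver ℂ}
    [IsAffine Y.left] [SmoothOfRelativeDimension m Y.hom] (π : Y ⟶ X) (k : ℕ)
    (hπ : Function.Injective (complexBetti.map (conjHom σ π) k)) :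
    Nonempty (ConjugationChart σ X k) := by
  obtain ⟨A⟩ := nonempty_analyticModel_of_isAffine m Y
  obtain ⟨A'⟩ := nonempty_analyticModel_of_isAffine m (conjugateVariety σ Y)
  obtain ⟨e, he, hr⟩ := exists_isRational_complexDeRhamIsoFamily_holds (Fin m → ℂ)
  exact
    ⟨{ m := m, Y := Y, π := π, E := Fin m → ℂ, an := A, anConj := A', deRham := e
       deRham_isNatural := he, deRham_isRational := hr k, injective_map := hπ }⟩

/-- **Identity charts**: for a smooth AFFINE `ℂ`-scheme `Y`, every `σ` and every degree `k`, the identity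
`𝟙_Y` is a conjugation chart for `(σ, Y, k)` (`(𝟙_Y)^σ = 𝟙_{Y^σ}` is injective on `Hᵏ`). No Jouanolou
device is needed in the affine case. [cite: CharlesSchnell2014Notes, §11.2.2 (11.2.1)–(11.2.3)] -/
theorem nonempty_conjugationChart_of_isAffine (σ : ℂ ≃+* ℂ) (m : ℕ) (Y : SchemeOver ℂ)
    [IsAffine Y.left] [SmoothOfRelativeDimension m Y.hom] (k : ℕ) :
    Nonempty (ConjugationChart σ Y k) := by
  refine nonempty_conjugationChart_of_injective σ (m := m) (𝟙 Y) k fun a b h ↦ ?_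
  have h1 : conjHom σ (𝟙 Y) = 𝟙 (conjugateVariety σ Y) := (baseChangeHom σ.toRingHom).map_id Y
  have hid : ∀ a : complexBetti (conjugateVariety σ Y) k, complexBetti.map (conjHom σ (𝟙 Y)) k a = a := by
    intro a
    rw [h1, complexBetti.map_id]
    rfl
  rwa [hid, hid] at h

/-- **Degree-zero charts on a smooth projective variety**: a complex point `x₀ : Spec ℂ ⟶ X` is a smooth
affine probe injective on `H⁰(X^σ(ℂ); ℂ)` (`X^σ` is smooth projective, so `X^σ(ℂ)` is path connected,
and `(Spec ℂ)^σ` has a complex point). [cite: CharlesSchnell2014Notes, §11.2.2 (11.2.1)–(11.2.3)] -/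
theorem nonempty_conjugationChart_zero (hX : IsSmoothProjective n X) (σ : ℂ ≃+* ℂ) :
    Nonempty (ConjugationChart σ X 0) := by
  have hXσ : IsSmoothProjective n (conjugateVariety σ X) := IsSmoothProjective.conjugateVariety_holds σ hX
  haveI := pathConnectedSpace_complexPoints hX
  haveI := pathConnectedSpace_complexPoints hXσ
  obtain ⟨x₀⟩ : Nonempty (ComplexPoints X) := inferInstance
  haveI : Nonempty (ComplexPoints (specOver ℂ ℂ)) := ⟨𝟙 _⟩
  haveI : Nonempty (ComplexPoints (conjugateVariety σ (specOver ℂ ℂ))) :=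
    nonempty_complexPoints_conjugateVariety σ
  exact nonempty_conjugationChart_of_injective σ (m := 0) (x₀ : specOver ℂ ℂ ⟶ X) 0
    (complexBetti_map_zero_injective _)

/-- **Charts above the dimension**: for `X` smooth projective of dimension `n` and `k > 2n`,
`Hᵏ(X^σ(ℂ); ℂ) = 0`, so a complex point is (trivially) an injective affine probe. [cite: HatcherAT2002, Thm. 3.26] -/
theorem nonempty_conjugationChart_of_lt (hX : IsSmoothProjective n X) (σ : ℂ ≃+* ℂ) {k : ℕ}
    (hk : 2 * n < k) : Nonempty (ConjugationChart σ X k) := by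
  have hXσ : IsSmoothProjective n (conjugateVariety σ X) := IsSmoothProjective.conjugateVariety_holds σ hX
  haveI := ComplexPoints.subsingleton_singularCohomology_of_lt hXσ ℂ (k := k) hk
  haveI := connectedSpace_complexPoints hX
  obtain ⟨x₀⟩ : Nonempty (ComplexPoints X) := inferInstance
  exact nonempty_conjugationChart_of_injective σ (m := 0) (x₀ : specOver ℂ ℂ ⟶ X) k
    fun a b _ ↦ Subsingleton.elim a b

end Probe

/-! ### §5 Degree-zero conjugation is canonical: `(κ · 1_X)^σ = σ(κ) · 1_{X^σ}` in every chart -/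

section DegreeZero

variable {n : ℕ} {X : SchemeOver ℂ}

/-- **Uniqueness: every chart conjugate of `κ · 1_X` is `σ(κ) · 1_{X^σ}`** (`κ ∈ ℂ`, `X` smooth
projective, `σ ∈ Aut ℂ`). In ANY chart `D` (smooth affine `Y`, any analytic models, any natural rationally
normalised family `e`, degree-zero scalar `λ_e = q ∈ ℚˣ`): the representing expression `ξ = ∑ fⱼ` has
`e[ξ] = κ · 1`, so (no exact `0`-forms) `∑ fⱼ ≡ κ/q` at every complex point of `Y`; its conjugate
`∑ fⱼ^σ` then takes the value `σ(κ/q) = σ(κ)/q` at every point of `Y^σ` (conjugation of functions is `σ`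
on values at the untwisted point, and `σ` fixes `q ∈ ℚ`), so `e[ξ^σ] = σ(κ) · 1_{(Y^σ)^an}`; finally
`(π^σ)^* c' = σ(κ) · (π^σ)^* 1` with `(π^σ)^*` injective on `H⁰`. This is Charles–Schnell's
`(λα)^σ = σ(λ) α^σ` ((11.2.3)) with `1^σ = 1`, computed by charts, in degree `0` — no Grothendieck
comparison is needed there. [cite: CharlesSchnell2014Notes, §11.2.2 (11.2.2)–(11.2.3)] -/
theorem IsConjugateClass.eq_of_degree_zero (hX : IsSmoothProjective n X) {σ : ℂ ≃+* ℂ} {κ : ℂ}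
    {c' : complexBetti (conjugateVariety σ X) 0}
    (h : IsConjugateClass σ X 0 (κ • singularCohomology.one ℂ (ComplexPoints X)) c') :
    c' = σ κ • singularCohomology.one ℂ (ComplexPoints (conjugateVariety σ X)) := by
  have hXσ : IsSmoothProjective n (conjugateVariety σ X) := IsSmoothProjective.conjugateVariety_holds σ hX
  haveI := pathConnectedSpace_complexPoints hX
  haveI := pathConnectedSpace_complexPoints hXσ
  obtain ⟨D, ξ, hξ, hξ', h1, h2⟩ := h
  -- the chart's de Rham family has ONE rational degree-zero scalar `q ≠ 0` on all its manifolds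
  obtain ⟨q, hq0, hq⟩ := exists_rat_unitScalar D.deRham_isNatural D.deRham_isRational
  have hone : ∀ (M : Type) [TopologicalSpace M] [ChartedSpace D.E M] [IsManifold 𝓘(ℝ, D.E) ∞ M]
      [T2Space M] [SigmaCompactSpace M],
      D.deRham M 0 (complexDeRhamCohomology.one D.E M) = (q : ℂ) • singularCohomology.one ℂ M := by
    intro M _ _ _ _ _
    rw [hq, apply_one_eq_unitScalar_smul D.deRham_isNatural]
  -- `Y^σ(ℂ)`, hence the conjugate model, is nonempty (injectivity of `(π^σ)^*` on `H⁰`)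
  haveI : Nonempty (ComplexPoints (conjugateVariety σ D.Y)) :=
    nonempty_complexPoints_of_injective (conjHom σ D.π) D.injective_map
  haveI : Nonempty D.anConj.carrier := ⟨D.anConj.homeomorph.symm (Classical.arbitrary _)⟩
  -- (1) the representing expression realises to the constant `κ / q`
  have hreal : complexDeRhamCohomology.mk D.E D.an.carrier 0 ⟨ξ.realize D.an, hξ⟩ =
      (κ / q) • complexDeRhamCohomology.one D.E D.an.carrier := by
    apply (D.deRham D.an.carrier 0).injective
    rw [← h1, map_smul, map_one_complexBetti, map_smul, singularCohomology.map_one,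
      complexDeRhamCohomology.one, ← map_smul, apply_mk_smul_cclosedOne D.deRham (hone D.an.carrier),
      div_mul_cancel₀ _ hq0]
  have hval : ∀ P : ComplexPoints D.Y,
      ∑ j : Fin ξ.size, AlgPoints.evalOrZero ⊤ (ξ.coef j) P = κ / q := by
    intro P
    have hx := apply_eq_of_mk_eq_smul_one hξ hreal (D.an.homeomorph.symm P) Fin.elim0
    rw [AlgFormExpr.realize_apply_of_degree_zero] at hx
    simp only [AnalyticModel.regularFun_apply] at hx
    have hP : D.an.toComplexPoints (D.an.homeomorph.symm P) = P := D.an.homeomorph.apply_symm_apply P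
    simpa only [hP] using hx
  -- (2) the conjugate expression realises to the constant `σ (κ / q) = σ κ / q`
  have hval' : ∀ x : D.anConj.carrier, (ξ.conj σ).realize D.anConj x Fin.elim0 = σ κ / q := by
    intro x
    rw [AlgFormExpr.realize_conj_apply_of_degree_zero, hval, map_div₀, map_ratCast]
  have hreal' : complexDeRhamCohomology.mk D.E D.anConj.carrier 0 ⟨(ξ.conj σ).realize D.anConj, hξ'⟩ =
      (σ κ / q) • complexDeRhamCohomology.one D.E D.anConj.carrier :=
    mk_eq_smul_one_of_forall_apply_eq hξ' hval'
  -- (3) read `c'` off the second chart identity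
  have hc' := singularCohomology.eq_smul_one ℂ c'
  rw [hc'] at h2 ⊢
  rw [map_smul, map_one_complexBetti, map_smul, singularCohomology.map_one, hreal',
    complexDeRhamCohomology.one, ← map_smul, apply_mk_smul_cclosedOne D.deRham (hone D.anConj.carrier),
    div_mul_cancel₀ _ hq0] at h2
  rw [smul_one_injective h2]

/-- **Existence, in a given degree-zero chart, of the conjugate `σ(κ) · 1`.** In every conjugation chart
`D` for `(σ, X, 0)` over any `ℂ`-scheme `X`, `σ(κ) · 1_{X^σ}` is conjugate to `κ · 1_X`: the constant
expression `κ/λ_e · 1` (`λ_e ∈ ℚˣ` the degree-zero scalar of the chart's family) represents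
`π^*(κ · 1) = κ · 1` (`e[κ/λ_e · 1] = κ · 1`), and its conjugate, the constant expression `σ(κ/λ_e) · 1 =
σ(κ)/λ_e · 1` on `Y^σ`, represents `σ(κ) · 1 = (π^σ)^*(σ(κ) · 1)`. [cite: CharlesSchnell2014Notes, §11.2.2 (11.2.1)–(11.2.3)] -/
theorem ConjugationChart.conjugates_smul_one_degree_zero {σ : ℂ ≃+* ℂ} (D : ConjugationChart σ X 0) (κ : ℂ) :
    D.Conjugates (κ • singularCohomology.one ℂ (ComplexPoints X))
      (σ κ • singularCohomology.one ℂ (ComplexPoints (conjugateVariety σ X))) := by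
  obtain ⟨q, hq0, hq⟩ := exists_rat_unitScalar D.deRham_isNatural D.deRham_isRational
  have hone : ∀ (M : Type) [TopologicalSpace M] [ChartedSpace D.E M] [IsManifold 𝓘(ℝ, D.E) ∞ M]
      [T2Space M] [SigmaCompactSpace M],
      D.deRham M 0 (complexDeRhamCohomology.one D.E M) = (q : ℂ) • singularCohomology.one ℂ M := by
    intro M _ _ _ _ _
    rw [hq, apply_one_eq_unitScalar_smul D.deRham_isNatural]
  -- the constant expression `κ/q · 1` on `Y`, and its two (closed) realisations
  have h1 : (⟨(AlgFormExpr.const D.Y (κ / q)).realize D.an, AlgFormExpr.realize_const_mem D.an _⟩ :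
      cclosedSmoothForms D.E D.an.carrier 0) = (κ / q) • cclosedOne D.E D.an.carrier :=
    Subtype.ext (AlgFormExpr.realize_const_eq_smul_cclosedOne D.an _)
  have hξ' : ((AlgFormExpr.const D.Y (κ / q)).conj σ).realize D.anConj ∈
      cclosedSmoothForms D.E D.anConj.carrier 0 :=
    AlgFormExpr.realize_conj_const_mem σ D.anConj _
  have h1' : (⟨((AlgFormExpr.const D.Y (κ / q)).conj σ).realize D.anConj, hξ'⟩ :
      cclosedSmoothForms D.E D.anConj.carrier 0) = σ (κ / q) • cclosedOne D.E D.anConj.carrier :=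
    Subtype.ext (AlgFormExpr.realize_conj_const_eq_smul_cclosedOne σ D.anConj _)
  refine ⟨AlgFormExpr.const D.Y (κ / q), AlgFormExpr.realize_const_mem D.an _, hξ', ?_, ?_⟩
  · change D.an.pullback 0 (complexBetti.map D.π 0 (κ • singularCohomology.one ℂ _)) =
      D.deRham D.an.carrier 0 (complexDeRhamCohomology.mk D.E D.an.carrier 0 ⟨_, _⟩)
    rw [h1, apply_mk_smul_cclosedOne D.deRham (hone D.an.carrier), map_smul, map_one_complexBetti,
      map_smul, singularCohomology.map_one, div_mul_cancel₀ _ hq0]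
  · change D.anConj.pullback 0 (complexBetti.map (conjHom σ D.π) 0 (σ κ • singularCohomology.one ℂ _)) =
      D.deRham D.anConj.carrier 0 (complexDeRhamCohomology.mk D.E D.anConj.carrier 0 ⟨_, hξ'⟩)
    rw [h1', apply_mk_smul_cclosedOne D.deRham (hone D.anConj.carrier), map_smul, map_one_complexBetti,
      map_smul, singularCohomology.map_one, map_div₀, map_ratCast, div_mul_cancel₀ _ hq0]

/-- **Degree-zero conjugation is canonical.** For `X` smooth projective, `σ ∈ Aut ℂ` and ANY `κ ∈ ℂ`:
`c' ∈ H⁰(X^σ(ℂ); ℂ)` is a `σ`-conjugate of `κ · 1_X` (in some chart — equivalently, by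
`IsConjugateClass.eq_of_degree_zero`, in any chart) if and only if `c' = σ(κ) · 1_{X^σ}`. In degree `0`
the tree's chart conjugation is therefore single-valued, non-vacuous and `σ`-SEMILINEAR — the degree-zero
instance of the content of the named facts `chartConjugation_canonical` and
`grothendieck_comparison_realize_surjective`, proved outright: Charles–Schnell's
`(σ⁻¹)^* : H⁰(X/ℂ) ⥲ H⁰(X^σ/ℂ)`, `(λ · 1)^σ = σ(λ) · 1` ((11.2.3)).
[cite: CharlesSchnell2014Notes, §11.2.2 (11.2.2)–(11.2.3)] -/
theorem isConjugateClass_degree_zero_iff (hX : IsSmoothProjective n X) (σ : ℂ ≃+* ℂ) (κ : ℂ)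
    (c' : complexBetti (conjugateVariety σ X) 0) :
    IsConjugateClass σ X 0 (κ • singularCohomology.one ℂ (ComplexPoints X)) c' ↔
      c' = σ κ • singularCohomology.one ℂ (ComplexPoints (conjugateVariety σ X)) := by
  refine ⟨IsConjugateClass.eq_of_degree_zero hX, ?_⟩
  rintro rfl
  obtain ⟨D⟩ := nonempty_conjugationChart_zero hX σ
  exact ⟨D, D.conjugates_smul_one_degree_zero κ⟩

/-- **Every degree-zero class on a smooth projective variety has a `σ`-conjugate**, namely
`σ(ε c) · 1_{X^σ}` where `c = ε(c) · 1_X` (`X(ℂ)` path connected): the existence conjunct of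
`IsAbsoluteHodgeClass` in degree `0`, unconditionally. [cite: CharlesSchnell2014Notes, §11.2.2 (11.2.3)] -/
theorem exists_isConjugateClass_degree_zero (hX : IsSmoothProjective n X) (σ : ℂ ≃+* ℂ)
    (c : complexBetti X 0) : ∃ c', IsConjugateClass σ X 0 c c' := by
  haveI := pathConnectedSpace_complexPoints hX
  rw [singularCohomology.eq_smul_one ℂ c]
  exact ⟨_, (isConjugateClass_degree_zero_iff hX σ _ _).2 rfl⟩

/-- **Rational degree-zero classes have rational conjugates**: every `σ`-conjugate of `r · 1_X`
(`r ∈ ℚ`) is `r · 1_{X^σ}` (`σ(r) = r`). [cite: CharlesSchnell2014Notes, §11.2.2 (11.2.3)] -/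
theorem IsConjugateClass.eq_of_degree_zero_rat (hX : IsSmoothProjective n X) {σ : ℂ ≃+* ℂ} (r : ℚ)
    {c' : complexBetti (conjugateVariety σ X) 0}
    (h : IsConjugateClass σ X 0 ((r : ℂ) • singularCohomology.one ℂ (ComplexPoints X)) c') :
    c' = (r : ℂ) • singularCohomology.one ℂ (ComplexPoints (conjugateVariety σ X)) := by
  rw [h.eq_of_degree_zero hX, map_ratCast]

end DegreeZero

/-! ### §6 The unconditional absolute Hodge classes -/

section Absolute

variable {n : ℕ} {X : SchemeOver ℂ}

/-- **Every rational degree-zero class on a smooth projective complex variety is absolute Hodge.**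
For `X/ℂ` smooth projective of dimension `n` and `c ∈ H⁰(X(ℂ); ℂ)` rational (so `c = r · 1`, `r ∈ ℚ`,
`X(ℂ)` being connected): `c` is of type `(0,0)`, for every `σ ∈ Aut ℂ` the conjugate `r · 1_{X^σ}` exists,
and EVERY conjugate, in every chart, is `r · 1_{X^σ} = (2πi/σ(2πi))⁰ · (r · 1_{X^σ})`, a rational
`(0,0)`-class (`isConjugateClass_degree_zero_iff`). These are NONZERO absolute Hodge classes on varieties of
every dimension — Deligne's `ℚ(0)`; neither Jouanolou's device nor Grothendieck's comparison theorem is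
used. [cite: CharlesSchnell2014Notes, Def. 11.2.3] [cite: Deligne1982HodgeCycles, §1 and §2 Ex. 2.1] -/
theorem isAbsoluteHodgeClass_degree_zero (hX : IsSmoothProjective n X) (c : complexBetti X (2 * 0))
    (hc : IsRationalClass c) : IsAbsoluteHodgeClass n X 0 c := by
  haveI := pathConnectedSpace_complexPoints hX
  obtain ⟨r, hr⟩ : ∃ r : ℚ, c = (r : ℂ) • singularCohomology.one ℂ (ComplexPoints X) :=
    isRationalClass_zero_iff.1 hc
  obtain ⟨A⟩ := nonempty_hodgeModel_holds hX
  refine ⟨hc, isOfHodgeType_zero_zero_zero A c, fun σ ↦ ⟨exists_isConjugateClass_degree_zero hX σ c,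
    fun c' hc' ↦ ?_⟩⟩
  have hXσ : IsSmoothProjective n (conjugateVariety σ X) := IsSmoothProjective.conjugateVariety_holds σ hX
  obtain ⟨Aσ⟩ := nonempty_hodgeModel_holds hXσ
  rw [hr] at hc'
  have h := IsConjugateClass.eq_of_degree_zero_rat hX r hc'
  refine ⟨c', ?_, isOfHodgeType_zero_zero_zero Aσ c', ?_⟩
  · rw [h]
    exact (isRationalClass_one _).smul r
  · rw [periodTwist, pow_zero, one_smul]

/-- The same in the hypothesis shape of Charles–Schnell 11.2.17 (the Hodge-type hypothesis is automatic in
degree `0`). [cite: CharlesSchnell2014Notes, Def. 11.2.3 and §11.2.5 Conj. 11.2.17] -/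
theorem isAbsoluteHodgeClass_of_degree_zero (hX : IsSmoothProjective n X) (c : complexBetti X (2 * 0))
    (hc : IsRationalClass c) (_hpp : IsOfHodgeType n X (2 * 0) 0 0 c) : IsAbsoluteHodgeClass n X 0 c :=
  isAbsoluteHodgeClass_degree_zero hX c hc

/-- **In degree zero, absolute Hodge = rational**: on a smooth projective `X`, `c ∈ H⁰(X(ℂ); ℂ)` is an
absolute Hodge class iff it is a rational class (iff `c ∈ ℚ · 1`). [cite: CharlesSchnell2014Notes, Def. 11.2.3] -/
theorem isAbsoluteHodgeClass_degree_zero_iff (hX : IsSmoothProjective n X) (c : complexBetti X (2 * 0)) :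
    IsAbsoluteHodgeClass n X 0 c ↔ IsRationalClass c :=
  ⟨IsAbsoluteHodgeClass.isRationalClass, isAbsoluteHodgeClass_degree_zero hX c⟩

/-- **Above the dimension every class is absolute Hodge.** For `X` smooth projective of dimension `n` and
`p > n`, every `c ∈ H²ᵖ(X(ℂ); ℂ)` is absolute Hodge: `H²ᵖ(X) = H²ᵖ(X^σ) = 0` (Hatcher 3.26; `X^σ` is smooth
projective of dimension `n`), so `c = 0`, and a complex point `Spec ℂ ⟶ X` is an affine probe injective on
`H²ᵖ(X^σ) = 0`. [cite: CharlesSchnell2014Notes, Def. 11.2.3] [cite: HatcherAT2002, Thm. 3.26] -/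
theorem isAbsoluteHodgeClass_of_lt (hX : IsSmoothProjective n X) {p : ℕ} (hnp : n < p)
    (c : complexBetti X (2 * p)) : IsAbsoluteHodgeClass n X p c := by
  haveI := ComplexPoints.subsingleton_singularCohomology_of_lt hX ℂ (k := 2 * p) (by omega)
  obtain rfl : c = 0 := Subsingleton.elim _ _
  refine ⟨IsRationalClass.zero,
    isOfHodgeType_zero_of_isSmoothProjective nonempty_hodgeModel_holds hX _ _ _, fun σ ↦ ?_⟩
  have hXσ : IsSmoothProjective n (conjugateVariety σ X) := IsSmoothProjective.conjugateVariety_holds σ hX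
  haveI := ComplexPoints.subsingleton_singularCohomology_of_lt hXσ ℂ (k := 2 * p) (by omega)
  refine ⟨?_, fun c' _ ↦ ⟨0, IsRationalClass.zero,
    isOfHodgeType_zero_of_isSmoothProjective nonempty_hodgeModel_holds hXσ _ _ _, Subsingleton.elim _ _⟩⟩
  obtain ⟨D⟩ := nonempty_conjugationChart_of_lt hX σ (k := 2 * p) (by omega)
  exact ⟨0, isConjugateClass_zero D⟩

/-- **Deligne 1982, Ex. 2.1 (a) in degree zero, as a theorem**: the `p = 0` instance of the tree's named
fact `deligne1982_cycleClass_absoluteHodge` ("the class of an algebraic cycle is absolute Hodge") — on a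
smooth projective `X` every rational class in `algebraicClasses X 0` (`= ⊤`: the fundamental class spans
`H⁰`) is absolute Hodge. [cite: Deligne1982HodgeCycles, §2 Ex. 2.1 (a)]
[cite: CharlesSchnell2014Notes, §11.2.2 (p. 480, before Def. 11.2.3)] -/
theorem cycleClass_absoluteHodge_degree_zero (hX : IsSmoothProjective n X) (c : complexBetti X (2 * 0))
    (hc : IsRationalClass c) (_halg : c ∈ algebraicClasses X 0) : IsAbsoluteHodgeClass n X 0 c :=
  isAbsoluteHodgeClass_degree_zero hX c hc

/-- **Deligne 1982, Ex. 2.1 (a) above the dimension, as a theorem**: the `p > dim X` instances of the named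
fact `deligne1982_cycleClass_absoluteHodge` (there `H²ᵖ = 0`). [cite: Deligne1982HodgeCycles, §2 Ex. 2.1 (a)] -/
theorem cycleClass_absoluteHodge_of_lt (hX : IsSmoothProjective n X) {p : ℕ} (hnp : n < p)
    (c : complexBetti X (2 * p)) (_hc : IsRationalClass c) (_halg : c ∈ algebraicClasses X p) :
    IsAbsoluteHodgeClass n X p c :=
  isAbsoluteHodgeClass_of_lt hX hnp c

/-- **The content of 11.2.17 per variety, exactly.** For `X` smooth projective of dimension `n`, the
property "the Hodge classes of `X` are absolute Hodge" (`HodgeClassesAreAbsoluteHodgeFor n X`,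
Charles–Schnell 11.2.17 for `X`) is equivalent to its restriction to the Hodge range `1 ≤ p ≤ n`: degree `0`
and degrees above the dimension hold unconditionally. [cite: CharlesSchnell2014Notes, §11.2.5 Conj. 11.2.17 (PDF p. 474)] -/
theorem hodgeClassesAreAbsoluteHodgeFor_iff_of_pos_le (hX : IsSmoothProjective n X) :
    HodgeClassesAreAbsoluteHodgeFor n X ↔
      ∀ (p : ℕ), 1 ≤ p → p ≤ n → ∀ c : complexBetti X (2 * p),
        IsRationalClass c → IsOfHodgeType n X (2 * p) p p c → IsAbsoluteHodgeClass n X p c := by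
  rw [hodgeClassesAreAbsoluteHodgeFor_iff_of_isSmoothProjective hX]
  refine ⟨fun h p _ _ c hc hpp ↦ h p c hc hpp, fun h p c hc hpp ↦ ?_⟩
  rcases Nat.eq_zero_or_pos p with rfl | hp
  · exact isAbsoluteHodgeClass_degree_zero hX c hc
  · rcases Nat.lt_or_ge n p with hnp | hpn
    · exact isAbsoluteHodgeClass_of_lt hX hnp c
    · exact h p hp hpn c hc hpp

/-- **The content of 11.2.18 per variety, exactly.** For `X` smooth projective of dimension `n`, the
property "the absolute Hodge classes of `X` are algebraic" (`AbsoluteHodgeClassesAreAlgebraicFor n X`,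
Charles–Schnell 11.2.18 for `X`) is equivalent to its restriction to the Hodge range `1 ≤ p ≤ n`: in degree
`0` every class is algebraic (`algebraicClasses_zero = ⊤`) and above the dimension every class vanishes.
[cite: CharlesSchnell2014Notes, §11.2.5 Conj. 11.2.18 (PDF p. 474)] -/
theorem absoluteHodgeClassesAreAlgebraicFor_iff_of_pos_le (hX : IsSmoothProjective n X) :
    AbsoluteHodgeClassesAreAlgebraicFor n X ↔
      ∀ (p : ℕ), 1 ≤ p → p ≤ n → ∀ c : complexBetti X (2 * p),
        IsAbsoluteHodgeClass n X p c → c ∈ algebraicClasses X p := by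
  rw [absoluteHodgeClassesAreAlgebraicFor_iff_of_isSmoothProjective hX]
  refine ⟨fun h p _ _ c hc ↦ h p c hc, fun h p c hc ↦ ?_⟩
  rcases Nat.eq_zero_or_pos p with rfl | hp
  · rw [algebraicClasses_zero]
    exact Submodule.mem_top
  · rcases Nat.lt_or_ge n p with hnp | hpn
    · haveI := ComplexPoints.subsingleton_singularCohomology_of_lt hX ℂ (k := 2 * p) (by omega)
      rw [Subsingleton.elim c 0]
      exact Submodule.zero_mem _
    · exact h p hp hpn c hc

/-- **Varieties of dimension `0`: the Hodge classes are absolute Hodge**, unconditionally — the first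
variety-level instance of Charles–Schnell 11.2.17 / Deligne–Milne 6.24 on the tree's carriers
(`HodgeClassesAreAbsoluteHodgeFor 0 X` for every smooth projective `X` of dimension `0`: the Hodge range
`1 ≤ p ≤ 0` is empty). [cite: CharlesSchnell2014Notes, §11.2.5 Conj. 11.2.17 (PDF p. 474)] -/
theorem hodgeClassesAreAbsoluteHodgeFor_of_dim_zero (hX : IsSmoothProjective 0 X) :
    HodgeClassesAreAbsoluteHodgeFor 0 X :=
  (hodgeClassesAreAbsoluteHodgeFor_iff_of_pos_le hX).2 fun _ hp hp0 ↦ absurd (hp.trans hp0) (by decide)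

/-- **Varieties of dimension `0`: the absolute Hodge classes are algebraic**, unconditionally
(`AbsoluteHodgeClassesAreAlgebraicFor 0 X`, Charles–Schnell 11.2.18 for `X` of dimension `0`).
[cite: CharlesSchnell2014Notes, §11.2.5 Conj. 11.2.18 (PDF p. 474)] -/
theorem absoluteHodgeClassesAreAlgebraicFor_of_dim_zero (hX : IsSmoothProjective 0 X) :
    AbsoluteHodgeClassesAreAlgebraicFor 0 X :=
  (absoluteHodgeClassesAreAlgebraicFor_iff_of_pos_le hX).2 fun _ hp hp0 ↦ absurd (hp.trans hp0) (by decide)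

/-- **The conjugation formula for algebraic classes holds in degree `0`** (anti-vacuity of the inline
binder (Z) of `CycleClassesAbsoluteHodgeOfCanonical`): every rational class `c ∈ N⁰ H⁰(X(ℂ); ℂ) = H⁰`
on a smooth projective `X` has, for every `σ`, a conjugate `(2πi/σ(2πi))⁰ • β` with `β` rational and
algebraic on `X^σ` — namely `β = r · 1_{X^σ}` for `c = r · 1_X` (`isConjugateClass_degree_zero_iff`).
[cite: CharlesSchnell2014Notes, §11.2.2 (p. 480, before Def. 11.2.3)] -/
theorem exists_conjugate_algebraic_degree_zero (hX : IsSmoothProjective n X) (σ : ℂ ≃+* ℂ)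
    (c : complexBetti X (2 * 0)) (hc : IsRationalClass c) (_halg : c ∈ algebraicClasses X 0) :
    ∃ β : complexBetti (conjugateVariety σ X) (2 * 0),
      IsRationalClass β ∧ β ∈ algebraicClasses (conjugateVariety σ X) 0 ∧
        IsConjugateClass σ X (2 * 0) c (periodTwist σ 0 • β) := by
  haveI := pathConnectedSpace_complexPoints hX
  obtain ⟨r, rfl⟩ := isRationalClass_zero_iff.1 hc
  refine ⟨(r : ℂ) • singularCohomology.one ℂ (ComplexPoints (conjugateVariety σ X)),
    (isRationalClass_one _).smul r, by rw [algebraicClasses_zero]; exact Submodule.mem_top, ?_⟩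
  rw [periodTwist, pow_zero, one_smul]
  have h := (isConjugateClass_degree_zero_iff hX σ (r : ℂ) _).2 rfl
  rwa [map_ratCast] at h

/-- **The conjugation formula for algebraic classes holds above the dimension** (anti-vacuity of the
binder (Z) for `p > dim X`: `H²ᵖ(X) = H²ᵖ(X^σ) = 0`, the conjugate `0` of `0` exists in the chart of a
complex point). [cite: CharlesSchnell2014Notes, §11.2.2 (p. 480, before Def. 11.2.3)] -/
theorem exists_conjugate_algebraic_of_lt (hX : IsSmoothProjective n X) {p : ℕ} (hnp : n < p)
    (σ : ℂ ≃+* ℂ) (c : complexBetti X (2 * p)) (_hc : IsRationalClass c) (_halg : c ∈ algebraicClasses X p) :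
    ∃ β : complexBetti (conjugateVariety σ X) (2 * p),
      IsRationalClass β ∧ β ∈ algebraicClasses (conjugateVariety σ X) p ∧
        IsConjugateClass σ X (2 * p) c (periodTwist σ p • β) := by
  haveI := ComplexPoints.subsingleton_singularCohomology_of_lt hX ℂ (k := 2 * p) (by omega)
  obtain rfl : c = 0 := Subsingleton.elim _ _
  obtain ⟨D⟩ := nonempty_conjugationChart_of_lt hX σ (k := 2 * p) (by omega)
  exact ⟨0, IsRationalClass.zero, Submodule.zero_mem _, by rw [smul_zero]; exact isConjugateClass_zero D⟩

end Absolute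

/-! ### §7 Grothendieck's comparison (G) in degree `0` and above the real dimension -/

section Grothendieck

variable {E : Type} [NormedAddCommGroup E] [NormedSpace ℂ E] [FiniteDimensional ℂ E]

/-- `Y^an` is connected for `Y` irreducible (SGA1 XII Prop. 2.4, the tree's
`ComplexPoints.isConnected_setOf_pt_mem_of_isIrreducible_holds`, transported along `Y^an ≃ₜ Y(ℂ)`).
[cite: SGA1, Exp. XII Prop. 2.4] -/
private theorem AnalyticModel.connectedSpace_carrier {m : ℕ} {Y : SchemeOver ℂ} [LocallyOfFiniteType Y.hom]
    [IrreducibleSpace Y.left] (A : AnalyticModel E m Y) : ConnectedSpace A.carrier := by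
  have h := Motives.ComplexPoints.isConnected_setOf_pt_mem_of_isIrreducible_holds Y isClosed_univ
    (IrreducibleSpace.isIrreducible_univ (X := ↥Y.left))
  haveI : ConnectedSpace (ComplexPoints Y) := by
    rw [connectedSpace_iff_univ]
    convert h using 1
    ext P
    simp
  exact A.homeomorph.symm.surjective.connectedSpace A.homeomorph.symm.continuous

/-- The constant expression `κ · 1` realises to the constant `0`-form `MForm.const κ`. [cite: Grothendieck1966, Thm. 1'] -/
theorem AlgFormExpr.realize_const_eq_const {m : ℕ} {Y : SchemeOver ℂ} (A : AnalyticModel E m Y) (κ : ℂ) :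
    (AlgFormExpr.const Y κ).realize A = MForm.const 𝓘(ℝ, E) A.carrier κ := by
  rw [AlgFormExpr.realize_const]
  funext x
  ext v
  simp [MForm.ofFun_apply, MForm.const_apply]

/-- **Grothendieck's comparison theorem in degree `0`, for an irreducible smooth affine `Y`**: the
degree-zero instance of the named fact `grothendieck_comparison_realize_surjective`, proved outright —
every class of `H⁰_dR(Y^an; ℂ)` is the class of the realisation of an algebraic `0`-form expression,
namely a CONSTANT: a closed `0`-form on the connected manifold `Y^an` (`Y` irreducible, SGA1 XII 2.4) is
constant (`eq_const_of_isClosedForm_zero`), and constants are regular functions (`AlgFormExpr.const`).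
(`H⁰(Γ(Y, Ω•)) = ℂ = H⁰(Y^an; ℂ)` for `Y` smooth affine irreducible.) [cite: Grothendieck1966, Thm. 1']
[cite: SGA1, Exp. XII Prop. 2.4] -/
theorem grothendieck_comparison_realize_surjective_degree_zero (m : ℕ) (Y : SchemeOver ℂ)
    [IsAffine Y.left] [SmoothOfRelativeDimension m Y.hom] [IrreducibleSpace Y.left]
    (A : AnalyticModel E m Y) (x : complexDeRhamCohomology E A.carrier 0) :
    ∃ (ξ : AlgFormExpr Y 0) (hξ : ξ.realize A ∈ cclosedSmoothForms E A.carrier 0),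
      complexDeRhamCohomology.mk E A.carrier 0 ⟨ξ.realize A, hξ⟩ = x := by
  haveI : Smooth Y.hom := SmoothOfRelativeDimension.smooth m Y.hom
  haveI : ConnectedSpace A.carrier := A.connectedSpace_carrier
  obtain ⟨α, rfl⟩ := complexDeRhamCohomology.mk_surjective x
  rcases isEmpty_or_nonempty A.carrier with hA | ⟨⟨x₀⟩⟩
  · -- no points: every form vanishes, the empty expression represents the class
    refine ⟨AlgFormExpr.const Y 0, AlgFormExpr.realize_const_mem A 0, congrArg _ (Subtype.ext ?_)⟩
    funext x
    exact isEmptyElim x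
  · obtain ⟨hs, hc⟩ := (mem_cclosedSmoothForms_iff (α : MForm 𝓘(ℝ, E) A.carrier ℂ 0)).1 α.2
    have hα : (α : MForm 𝓘(ℝ, E) A.carrier ℂ 0) = MForm.const 𝓘(ℝ, E) A.carrier (α.1 x₀ ![]) :=
      eq_const_of_isClosedForm_zero hs hc x₀
    refine ⟨AlgFormExpr.const Y (α.1 x₀ ![]), AlgFormExpr.realize_const_mem A _, congrArg _ (Subtype.ext ?_)⟩
    change (AlgFormExpr.const Y (α.1 x₀ ![])).realize A = (α : MForm 𝓘(ℝ, E) A.carrier ℂ 0)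
    rw [AlgFormExpr.realize_const_eq_const, ← hα]

/-- **Grothendieck's comparison theorem above the real dimension**: for `k > 2m = dim_ℝ Y^an` every
complex `k`-form on `Y^an` vanishes, so every class of `Hᵏ_dR(Y^an; ℂ)` (`= 0`) is the class of the empty
expression — the degrees `k > 2m` of the named fact `grothendieck_comparison_realize_surjective`, proved
outright. [cite: Grothendieck1966, Thm. 1'] [cite: VoisinHodgeI2002, §2.3.1] -/
theorem grothendieck_comparison_realize_surjective_of_lt (m : ℕ) (Y : SchemeOver ℂ)
    [IsAffine Y.left] [SmoothOfRelativeDimension m Y.hom] (A : AnalyticModel E m Y) {k : ℕ}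
    (hk : 2 * m < k) (x : complexDeRhamCohomology E A.carrier k) :
    ∃ (ξ : AlgFormExpr Y k) (hξ : ξ.realize A ∈ cclosedSmoothForms E A.carrier k),
      complexDeRhamCohomology.mk E A.carrier k ⟨ξ.realize A, hξ⟩ = x := by
  obtain ⟨α, rfl⟩ := complexDeRhamCohomology.mk_surjective x
  have hk' : 2 * Module.finrank ℂ E < k := by rw [A.isAnalytification.finrank_eq]; exact hk
  let ξ : AlgFormExpr Y k := ⟨0, Fin.elim0, Fin.elim0⟩
  have hξ : ξ.realize A = 0 := ConjugationChart.realize_of_size_zero ξ rfl A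
  refine ⟨ξ, hξ ▸ Submodule.zero_mem _, congrArg _ (Subtype.ext ?_)⟩
  change ξ.realize A = (α : MForm 𝓘(ℝ, E) A.carrier ℂ k)
  rw [hξ, mform_eq_zero_of_two_mul_finrank_lt (α : MForm 𝓘(ℝ, E) A.carrier ℂ k) hk']

end Grothendieck

end Literature.AlgebraicGeometry.HodgeTheory

end
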